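import Literature.Computability.Cryptography.LWERegevAsymptotics
import Mathlib.Analysis.SpecificLimits.Normed
import Mathlib.Analysis.Complex.ExponentialBounds
import Mathlib.Analysis.Real.Pi.Bounds
import Mathlib.Analysis.SpecialFunctions.Exp
import HarnessLib

/-!
# Micciancio–Regev 2007, proof of Thm. 5.23 (`GapCVP′ → SIS′`): the error budget "for all sufficiently large `n`" — proved

Topic `Computability/Cryptography` (family `pqc`); serves the decomposition of the named fact
`Literature.Computability.Cryptography.MicciancioRegev2007_gapCVP'_to_SIS'` (MR07 Thm. 5.23 proper,
`GapSVPToSIS.lean`). The NO-case analysis of the reduction (authors' version pp. 29–31) is carried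
out with `ε = 2⁻ⁿ`, oracle success probability `δ ≥ 1/n^c`, `N = n³m³` witness vectors, `K = √(nm)`,
`ℓ = 2sβ`, `σ = N 2⁻ⁿ(1+ε)/(1-ε)`, and closes with four "for all sufficiently large `n`" claims, which
this file PROVES as eventual inequalities in `n` for polynomially bounded `m(n)`
(`Literature.Computability.Cryptography.LWE.IsPolyBounded`, the hypothesis of the named fact):

* `eventually_two_inv_pow_mul_lt_inv_pow` — p. 30, "`δ - εm/2 > δ/2` for all sufficiently large `n`":
  `2⁻ⁿ m(n) < 1/n^c` eventually (so `δ ≥ 1/n^c ⇒ δ - 2⁻ⁿm/2 > δ/2`, `sub_half_mul_gt_half`).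
* `eventually_mul_exp_neg_half_lt` — p. 30, "`N e^{-n/2} < 2^{-n/2}`" for any polynomially bounded
  `N(n)` (here `2^{-n/2}` is `(√2)⁻ⁿ`); the preceding step `N(1 - δ/2)^{n/δ} ≤ N e^{-n/2}` and the
  block argument are `Literature.Probability.Moments.MicciancioRegev2007.measureReal_card_successes_lt_le`,
  `….one_sub_half_pow_le_exp` (`IndependentTrialBlocks.lean`).
* `exp_neg_hoeffding_le` — test (b): for `n ≥ 3` the Hoeffding bound `e^{-N(1/2 - 2·2⁻ⁿ)²/2}` of
  `Literature.Probability.Moments.MicciancioRegev2007.measureReal_half_le_sum_cos_div_le` with the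
  mean bound `2 · 2⁻ⁿ` of eq. (16) is at most `e^{-N/32}`.
* `lemma520_main_term_eq` — test (c), the printed identity `e^{-N/K⁴}(4√n K²)ⁿ = (4e^{-m} n^{1.5} m)ⁿ`
  for `N = n³m³`, `K = √(nm)`; `lemma520_main_term_le_of_le` — it is `≤ 2⁻ⁿ` as soon as
  `192 ≤ m` and `n ≤ m`.
* `eventually_side_condition_18` — the side condition of eq. (18)
  (`MRGapCVPWitness.lean`, `…integral_inner_witness_sq_le_sq`): `1/(2π) + ε/(1-ε) + (ε/(1-ε))² m(n) ≤ 1`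
  eventually.
* `eventually_noCase_error_le` — the four NO-case error terms together are eventually below any
  `η > 0`, for the REPAIRED sample count `N = n⁴m³` (see the caveat) and every polynomially bounded
  `m` with `m(n) ≥ 1`.

## Caveat on the printed sample count (recorded, not a misstatement of the theorem)

With `N = n³m³` and `K = √(nm)` the printed estimate "`e^{-N/K⁴}(4√nK²)ⁿ + Nσ ≤ (4e^{-m}n^{1.5}m)ⁿ +
N²2⁻ⁿ⁺¹ ≤ 2^{-n/2}`" (p. 30) needs `4e^{-m} n^{1.5} m < 1`, i.e. `m ≳ 1.5 ln n + ln m`: true in the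
paper's applications (`m(n) = Θ(n log n)`, p. 28) but not for every polynomially bounded `m` allowed by
the statement of Thm. 5.23 (e.g. bounded `m`). The theorem itself is unaffected: the reduction may use
`N = n⁴m³` samples, for which `e^{-N/K⁴}(4√nK²)ⁿ = (4 n^{1.5} m e^{-nm})ⁿ ≤ 2⁻ⁿ` for all `m ≥ 1` and
all large `n` (`lemma520_main_term_le_of_repaired`, stated for `n ≥ 192`); `eventually_noCase_error_le` is
stated for that choice,
and `lemma520_main_term_le_of_le` covers the printed choice under `n ≤ m(n)`.

## References

* D. Micciancio, O. Regev, *Worst-case to average-case reductions based on Gaussian measures*,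
  SIAM J. Comput. 37 (2007) 267–302; authors' version (`lit read doi:10.1137/S0097539705447360`),
  proof of Thm. 5.23, pp. 29–31.
-/

noncomputable section

open Filter Real
open scoped Topology

namespace Literature.Computability.Cryptography

namespace MicciancioRegev2007

open LWE LWE.RegevReduction

/-! ### `δ - εm/2 > δ/2` (p. 30) -/

/-- If `εm < δ` then `δ - εm/2 > δ/2` (p. 30: "with probability at least `δ - εm/2 > δ/2`").
[cite: MicciancioRegev2007, Thm. 5.23 (proof, p. 30)] -/
theorem sub_half_mul_gt_half {δ ε m : ℝ} (h : ε * m < δ) : δ / 2 < δ - ε * m / 2 := by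
  linarith

/-- **"for all sufficiently large `n`"** (p. 30): for polynomially bounded `m` and every `c`,
eventually `2⁻ⁿ m(n) < 1/n^c` — so for a non-negligible success probability `δ ≥ 1/n^c` the
statistical-distance loss `εm/2 = 2⁻ⁿ m/2` of Lemmas 5.7/5.8 leaves `δ - εm/2 > δ/2`.
[cite: MicciancioRegev2007, Thm. 5.23 (proof, p. 30)] -/
theorem eventually_two_inv_pow_mul_lt_inv_pow {m : ℕ → ℕ} (hm : IsPolyBounded m) (c : ℕ) :
    ∀ᶠ n : ℕ in atTop, (2⁻¹ : ℝ) ^ n * m n < 1 / (n : ℝ) ^ c := by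
  obtain ⟨d, hd⟩ := IsPolyBounded.eventually_le_pow hm
  have h2 := eventually_mul_pow_le_two_pow (d + c) 2
  filter_upwards [hd, h2, eventually_ge_atTop 1] with n hmn h2n hn1
  have hn : (0 : ℝ) < n := by exact_mod_cast hn1
  have hmR : (m n : ℝ) ≤ (n : ℝ) ^ d := by exact_mod_cast hmn
  have h2pos : (0 : ℝ) < 2 ^ n := by positivity
  rw [inv_pow, lt_div_iff₀ (by positivity), inv_mul_eq_div, div_mul_eq_mul_div, div_lt_one h2pos]
  calc (m n : ℝ) * (n : ℝ) ^ c ≤ (n : ℝ) ^ d * (n : ℝ) ^ c := by gcongr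
    _ = (n : ℝ) ^ (d + c) := by rw [pow_add]
    _ < 2 * (n : ℝ) ^ (d + c) := by
        have : 0 < (n : ℝ) ^ (d + c) := by positivity
        linarith
    _ ≤ 2 ^ n := h2n

/-! ### `N e^{-n/2} < 2^{-n/2}` (p. 30) -/

/-- `e^{n/2} · (√2)⁻ⁿ = (√(e/2))ⁿ`. [folklore] -/
theorem sqrt_exp_one_div_two_pow (n : ℕ) :
    Real.sqrt (Real.exp 1 / 2) ^ n = Real.exp ((n : ℝ) / 2) * (Real.sqrt 2)⁻¹ ^ n := by
  rw [Real.sqrt_div (Real.exp_pos 1).le, div_eq_mul_inv, mul_pow, ← Real.exp_half,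
    ← Real.exp_nat_mul]
  congr 2
  ring

/-- **"`N e^{-n/2} < 2^{-n/2}`"** (p. 30) for every polynomially bounded `N(n)` (in print
`N = n³m³`), eventually in `n`; `2^{-n/2}` is written `(√2)⁻ⁿ`. Proof: `N(n) ≤ n^d < (√(e/2))ⁿ`
eventually, as `e > 2`. [cite: MicciancioRegev2007, Thm. 5.23 (proof, p. 30)] -/
theorem eventually_mul_exp_neg_half_lt {N : ℕ → ℕ} (hN : IsPolyBounded N) :
    ∀ᶠ n : ℕ in atTop, (N n : ℝ) * Real.exp (-((n : ℝ) / 2)) < (Real.sqrt 2)⁻¹ ^ n := by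
  obtain ⟨d, hd⟩ := IsPolyBounded.eventually_le_pow hN
  have hr : 1 < Real.sqrt (Real.exp 1 / 2) := by
    rw [Real.lt_sqrt zero_le_one, one_pow, lt_div_iff₀ two_pos, one_mul]
    exact Real.exp_one_gt_two
  have ht := tendsto_pow_const_div_const_pow_of_one_lt d hr
  have hlt : ∀ᶠ n : ℕ in atTop, (n : ℝ) ^ d / Real.sqrt (Real.exp 1 / 2) ^ n < 1 :=
    ht.eventually (gt_mem_nhds zero_lt_one)
  filter_upwards [hd, hlt] with n hNn hn
  have hrpos : 0 < Real.sqrt (Real.exp 1 / 2) ^ n := pow_pos (by positivity) n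
  rw [div_lt_one hrpos, sqrt_exp_one_div_two_pow] at hn
  have hNR : (N n : ℝ) ≤ (n : ℝ) ^ d := by exact_mod_cast hNn
  have hexp : 0 < Real.exp (-((n : ℝ) / 2)) := Real.exp_pos _
  calc (N n : ℝ) * Real.exp (-((n : ℝ) / 2)) ≤ (n : ℝ) ^ d * Real.exp (-((n : ℝ) / 2)) := by gcongr
    _ < Real.exp ((n : ℝ) / 2) * (Real.sqrt 2)⁻¹ ^ n * Real.exp (-((n : ℝ) / 2)) :=
        mul_lt_mul_of_pos_right hn hexp
    _ = (Real.sqrt 2)⁻¹ ^ n := by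
        rw [mul_comm (Real.exp _), mul_assoc, ← Real.exp_add, add_neg_cancel, Real.exp_zero, mul_one]

/-! ### Test (b): the Hoeffding term (p. 30) -/

/-- **Test (b)** (p. 30: "`f_W(t) ≥ 1/2` with probability at most `e^{-N(1/2 - 2⁻ⁿ⁺¹)²/4} = 2^{-Ω(N)}`";
the tree's Hoeffding form has the exponent `/2`): for `n ≥ 3` (so `2 · 2⁻ⁿ ≤ 1/4`) and `N ≥ 0`,
`e^{-N(1/2 - 2·2⁻ⁿ)²/2} ≤ e^{-N/32}`. [cite: MicciancioRegev2007, Thm. 5.23 (proof, p. 30)] -/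
theorem exp_neg_hoeffding_le {n : ℕ} (hn : 3 ≤ n) {N : ℝ} (hN : 0 ≤ N) :
    Real.exp (-(N * (1 / 2 - 2 * (2⁻¹ : ℝ) ^ n) ^ 2 / 2)) ≤ Real.exp (-(N / 32)) := by
  have hε : 2 * (2⁻¹ : ℝ) ^ n ≤ 1 / 4 := by
    calc 2 * (2⁻¹ : ℝ) ^ n ≤ 2 * (2⁻¹ : ℝ) ^ 3 :=
          mul_le_mul_of_nonneg_left (pow_le_pow_of_le_one (by norm_num) (by norm_num) hn) (by norm_num)
      _ = 1 / 4 := by norm_num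
  have hsq : (1 / 16 : ℝ) ≤ (1 / 2 - 2 * (2⁻¹ : ℝ) ^ n) ^ 2 := by
    have h14 : (1 / 4 : ℝ) ≤ 1 / 2 - 2 * (2⁻¹ : ℝ) ^ n := by linarith
    nlinarith
  rw [Real.exp_le_exp]
  have : N / 32 ≤ N * (1 / 2 - 2 * (2⁻¹ : ℝ) ^ n) ^ 2 / 2 := by
    rw [div_le_div_iff₀ (by norm_num) (by norm_num)]
    nlinarith
  linarith

/-! ### Test (c): the main term of Lemma 5.20 (p. 30) -/

/-- **The printed identity** (p. 30): with `N = n³m³` and `K = √(nm)`,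
`e^{-N/K⁴} (4√n K²)ⁿ = (4 e^{-m} n^{1.5} m)ⁿ` (`K⁴ = n²m²`, `N/K⁴ = nm`, `√n K² = n^{1.5} m`), for
`n, m ≥ 1`. [cite: MicciancioRegev2007, Thm. 5.23 (proof, p. 30)] -/
theorem lemma520_main_term_eq {n m : ℕ} (hn : 1 ≤ n) (hm : 1 ≤ m) :
    Real.exp (-(((n : ℝ) ^ 3 * (m : ℝ) ^ 3) / Real.sqrt ((n : ℝ) * m) ^ 4)) *
        (4 * Real.sqrt n * Real.sqrt ((n : ℝ) * m) ^ 2) ^ n =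
      (4 * Real.exp (-(m : ℝ)) * ((n : ℝ) * Real.sqrt n) * m) ^ n := by
  have hn0 : (0 : ℝ) < n := by exact_mod_cast hn
  have hm0 : (0 : ℝ) < m := by exact_mod_cast hm
  have hs2 : Real.sqrt ((n : ℝ) * m) ^ 2 = (n : ℝ) * m := Real.sq_sqrt (by positivity)
  have hs4 : Real.sqrt ((n : ℝ) * m) ^ 4 = ((n : ℝ) * m) ^ 2 := by
    rw [show (4 : ℕ) = 2 * 2 from rfl, pow_mul, hs2]
  rw [hs4, hs2]
  have hexp : Real.exp (-(((n : ℝ) ^ 3 * (m : ℝ) ^ 3) / (((n : ℝ) * m) ^ 2))) = Real.exp (-(m : ℝ)) ^ n := by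
    rw [← Real.exp_nat_mul]
    congr 1
    field_simp
  rw [hexp, ← mul_pow]
  congr 1
  ring

/-- `8 x³ ≤ eˣ` for `x ≥ 192` (from `x⁴/4! ≤ eˣ`). [folklore] -/
theorem eight_mul_pow_three_le_exp {x : ℝ} (hx : 192 ≤ x) : 8 * x ^ 3 ≤ Real.exp x := by
  have h4 := Real.pow_div_factorial_le_exp x (by linarith) 4
  have hfac : ((Nat.factorial 4 : ℕ) : ℝ) = 24 := by norm_num [Nat.factorial]
  rw [hfac] at h4
  have hx3 : 0 ≤ x ^ 3 := by positivity
  calc 8 * x ^ 3 ≤ x / 24 * x ^ 3 := by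
        apply mul_le_mul_of_nonneg_right _ hx3
        linarith
    _ = x ^ 4 / 24 := by ring
    _ ≤ Real.exp x := h4

/-- **Test (c), printed sample count**: if `192 ≤ m` and `n ≤ m` (e.g. `m(n) = Θ(n log n)` as in
MR07's applications, `n` large) then `(4 e^{-m} n^{1.5} m)ⁿ ≤ 2⁻ⁿ`, because
`4 n^{1.5} m ≤ 4 m³ ≤ e^m/2`. [cite: MicciancioRegev2007, Thm. 5.23 (proof, p. 30)] -/
theorem lemma520_main_term_le_of_le {n m : ℕ} (hm : 192 ≤ m) (hnm : n ≤ m) :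
    (4 * Real.exp (-(m : ℝ)) * ((n : ℝ) * Real.sqrt n) * m) ^ n ≤ (2⁻¹ : ℝ) ^ n := by
  have hmR : (192 : ℝ) ≤ m := by exact_mod_cast hm
  have hnmR : (n : ℝ) ≤ m := by exact_mod_cast hnm
  have hm1 : (1 : ℝ) ≤ m := by linarith
  have hbase_nn : 0 ≤ 4 * Real.exp (-(m : ℝ)) * ((n : ℝ) * Real.sqrt n) * m := by positivity
  refine pow_le_pow_left₀ hbase_nn ?_ n
  -- `n √n ≤ m · m`
  have hsqrt : Real.sqrt n ≤ m := by
    calc Real.sqrt n ≤ Real.sqrt m := Real.sqrt_le_sqrt hnmR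
      _ ≤ m := by
          rw [Real.sqrt_le_left (by linarith)]
          nlinarith
  have hnn : (n : ℝ) * Real.sqrt n ≤ m * m :=
    mul_le_mul hnmR hsqrt (Real.sqrt_nonneg _) (by linarith)
  have hexp := eight_mul_pow_three_le_exp hmR
  have hE : 0 < Real.exp (m : ℝ) := Real.exp_pos _
  rw [Real.exp_neg]
  calc 4 * (Real.exp (m : ℝ))⁻¹ * ((n : ℝ) * Real.sqrt n) * m
      ≤ 4 * (Real.exp (m : ℝ))⁻¹ * (m * m) * m := by gcongr
    _ = (8 * (m : ℝ) ^ 3) / Real.exp m / 2 := by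
        field_simp
        ring
    _ ≤ Real.exp (m : ℝ) / Real.exp m / 2 := by gcongr
    _ = 2⁻¹ := by rw [div_self hE.ne']; norm_num

/-- **Test (c), repaired sample count** `N = n⁴m³` (caveat in the module docstring): with `K = √(nm)`,
`e^{-N/K⁴}(4√nK²)ⁿ = (4 n^{1.5} m e^{-nm})ⁿ ≤ 2⁻ⁿ` for all `n ≥ 192` and `m ≥ 1`
(`4 √n · nm ≤ 4 (nm)³` and `8x³ ≤ eˣ` for `x = nm ≥ 192`; the constant `192` is immaterial).
[cite: MicciancioRegev2007, Thm. 5.23 (proof, p. 30)] -/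
theorem lemma520_main_term_le_of_repaired {n m : ℕ} (hn : 192 ≤ n) (hm : 1 ≤ m) :
    Real.exp (-(((n : ℝ) ^ 4 * (m : ℝ) ^ 3) / Real.sqrt ((n : ℝ) * m) ^ 4)) *
        (4 * Real.sqrt n * Real.sqrt ((n : ℝ) * m) ^ 2) ^ n ≤ (2⁻¹ : ℝ) ^ n := by
  have hnR : (192 : ℝ) ≤ n := by exact_mod_cast hn
  have hmR : (1 : ℝ) ≤ m := by exact_mod_cast hm
  have hn0 : (0 : ℝ) < n := by linarith
  have hm0 : (0 : ℝ) < m := by linarith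
  have hs2 : Real.sqrt ((n : ℝ) * m) ^ 2 = (n : ℝ) * m := Real.sq_sqrt (by positivity)
  have hs4 : Real.sqrt ((n : ℝ) * m) ^ 4 = ((n : ℝ) * m) ^ 2 := by
    rw [show (4 : ℕ) = 2 * 2 from rfl, pow_mul, hs2]
  rw [hs4, hs2]
  have hexp : Real.exp (-(((n : ℝ) ^ 4 * (m : ℝ) ^ 3) / (((n : ℝ) * m) ^ 2))) =
      Real.exp (-((n : ℝ) * m)) ^ n := by
    rw [← Real.exp_nat_mul]
    congr 1
    field_simp
  rw [hexp, ← mul_pow]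
  have hbase_nn : 0 ≤ Real.exp (-((n : ℝ) * m)) * (4 * Real.sqrt n * ((n : ℝ) * m)) := by positivity
  refine pow_le_pow_left₀ hbase_nn ?_ n
  -- `4 √n · nm ≤ 4 (nm)³` and `8 (nm)³ ≤ e^{nm}`
  set x : ℝ := (n : ℝ) * m with hx
  have hx192 : (192 : ℝ) ≤ x := by
    rw [hx]
    nlinarith
  have hsqrt : Real.sqrt n ≤ x ^ 2 := by
    have h1 : Real.sqrt n ≤ n := by
      rw [Real.sqrt_le_left hn0.le]
      nlinarith
    calc Real.sqrt n ≤ n := h1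
      _ ≤ x := by rw [hx]; exact le_mul_of_one_le_right hn0.le hmR
      _ ≤ x ^ 2 := by nlinarith
  have h8 := eight_mul_pow_three_le_exp hx192
  have hE : 0 < Real.exp x := Real.exp_pos _
  rw [Real.exp_neg]
  calc (Real.exp x)⁻¹ * (4 * Real.sqrt n * x) ≤ (Real.exp x)⁻¹ * (4 * x ^ 2 * x) := by gcongr
    _ = (8 * x ^ 3) / Real.exp x / 2 := by
        field_simp
        ring
    _ ≤ Real.exp x / Real.exp x / 2 := by gcongr
    _ = 2⁻¹ := by rw [div_self hE.ne']; norm_num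

/-! ### The side condition of eq. (18) (p. 31) -/

/-- **Eq. (18), "`≤ s²β²`" for all sufficiently large `n`** (p. 31): with `ε = 2⁻ⁿ` and polynomially
bounded `m`, eventually `1/(2π) + ε/(1-ε) + (ε/(1-ε))² m(n) ≤ 1` (indeed `→ 1/(2π) < 1/6`), the
hypothesis `hnum` of `Literature.Algebra.EuclideanLattices.MicciancioRegev2007.integral_inner_witness_sq_le_sq`.
[cite: MicciancioRegev2007, Thm. 5.23 (proof, p. 31, eq. (18))] -/
theorem eventually_side_condition_18 {m : ℕ → ℕ} (hm : IsPolyBounded m) :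
    ∀ᶠ n : ℕ in atTop, 1 / (2 * π) + (2⁻¹ : ℝ) ^ n / (1 - (2⁻¹ : ℝ) ^ n) +
        ((2⁻¹ : ℝ) ^ n / (1 - (2⁻¹ : ℝ) ^ n)) ^ 2 * m n ≤ 1 := by
  have h := eventually_two_inv_pow_mul_lt_inv_pow hm 0
  filter_upwards [h, eventually_ge_atTop 5] with n hmn hn5
  simp only [pow_zero, div_one] at hmn
  -- `ε ≤ 1/32`, `ε/(1-ε) ≤ 2ε`, `(ε/(1-ε))² m ≤ 4 ε (ε m) < 4ε`, and `1/(2π) < 1/6`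
  have hε : (2⁻¹ : ℝ) ^ n ≤ 1 / 32 := by
    calc (2⁻¹ : ℝ) ^ n ≤ (2⁻¹ : ℝ) ^ 5 := pow_le_pow_of_le_one (by norm_num) (by norm_num) hn5
      _ = 1 / 32 := by norm_num
  have hε0 : 0 < (2⁻¹ : ℝ) ^ n := by positivity
  set ε : ℝ := (2⁻¹ : ℝ) ^ n with hεdef
  have h1ε : 3 / 4 ≤ 1 - ε := by linarith
  have hfrac : ε / (1 - ε) ≤ 2 * ε := by
    rw [div_le_iff₀ (by linarith)]
    nlinarith
  have hfrac0 : 0 ≤ ε / (1 - ε) := div_nonneg hε0.le (by linarith)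
  have hπ : 1 / (2 * π) < 1 / 6 := by
    rw [div_lt_div_iff₀ (by positivity) (by norm_num)]
    linarith [Real.pi_gt_three]
  have hm0 : (0 : ℝ) ≤ m n := Nat.cast_nonneg _
  have hsq : (ε / (1 - ε)) ^ 2 * m n ≤ 4 * ε * (ε * m n) := by
    calc (ε / (1 - ε)) ^ 2 * m n ≤ (2 * ε) ^ 2 * m n := by gcongr
      _ = 4 * ε * (ε * m n) := by ring
  have hεm : ε * m n < 1 := hmn
  have hεX : 4 * ε * (ε * m n) ≤ 4 * ε := by
    have : ε * m n ≤ 1 := hεm.le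
    nlinarith
  linarith

/-! ### The NO-case error terms together (pp. 29–31), repaired sample count `N = n⁴m³` -/

/-- `n⁴ m(n)³` is polynomially bounded when `m` is. [folklore] -/
theorem isPolyBounded_pow_four_mul_pow_three {m : ℕ → ℕ} (hm : IsPolyBounded m) :
    IsPolyBounded fun n => n ^ 4 * m n ^ 3 := by
  obtain ⟨p, hp⟩ := hm
  refine ⟨Polynomial.X ^ 4 * p ^ 3, fun n => ?_⟩
  rw [Polynomial.eval_mul, Polynomial.eval_pow, Polynomial.eval_X, Polynomial.eval_pow]
  exact Nat.mul_le_mul_left _ (Nat.pow_le_pow_left (hp n) 3)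

/-- `n⁴ m(n)³ · m(n)` is polynomially bounded when `m` is. [folklore] -/
theorem isPolyBounded_pow_four_mul_pow_three_mul {m : ℕ → ℕ} (hm : IsPolyBounded m) :
    IsPolyBounded fun n => n ^ 4 * m n ^ 3 * m n := by
  obtain ⟨p, hp⟩ := hm
  refine ⟨Polynomial.X ^ 4 * p ^ 3 * p, fun n => ?_⟩
  rw [Polynomial.eval_mul, Polynomial.eval_mul, Polynomial.eval_pow, Polynomial.eval_X,
    Polynomial.eval_pow]
  exact Nat.mul_le_mul (Nat.mul_le_mul_left _ (Nat.pow_le_pow_left (hp n) 3)) (hp n)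

/-- **The NO-case failure probability of the reduction is eventually below any `η > 0`** (pp. 29–31,
with the sample count `N = n⁴m³` of the caveat in the module docstring, `K = √(nm)`, `ε = 2⁻ⁿ`, the
per-sample tail bound `σ = m (1+ε)/(1-ε) 2⁻ⁿ` of eq. (17) and the mean bound `2·2⁻ⁿ` of eq. (16)): for
polynomially bounded `m` with `m(n) ≥ 1`, eventually in `n`,
`N e^{-n/2}` (repetitions) `+ e^{-N(1/2 - 2·2⁻ⁿ)²/2}` (test (b)) `+ e^{-N/K⁴}(4√nK²)ⁿ + Nσ` (test (c))
`≤ η`. [cite: MicciancioRegev2007, Thm. 5.23 (proof, pp. 29–31)] -/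
theorem eventually_noCase_error_le {m : ℕ → ℕ} (hm : IsPolyBounded m) (hm1 : ∀ n, 1 ≤ m n) {η : ℝ}
    (hη : 0 < η) :
    ∀ᶠ n : ℕ in atTop,
      ((n : ℝ) ^ 4 * (m n : ℝ) ^ 3) * Real.exp (-((n : ℝ) / 2)) +
        Real.exp (-(((n : ℝ) ^ 4 * (m n : ℝ) ^ 3) * (1 / 2 - 2 * (2⁻¹ : ℝ) ^ n) ^ 2 / 2)) +
        (Real.exp (-(((n : ℝ) ^ 4 * (m n : ℝ) ^ 3) / Real.sqrt ((n : ℝ) * m n) ^ 4)) *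
            (4 * Real.sqrt n * Real.sqrt ((n : ℝ) * m n) ^ 2) ^ n +
          ((n : ℝ) ^ 4 * (m n : ℝ) ^ 3) *
            ((m n : ℝ) * ((1 + (2⁻¹ : ℝ) ^ n) / (1 - (2⁻¹ : ℝ) ^ n) * (2⁻¹ : ℝ) ^ n))) ≤ η := by
  -- polynomial bounds: `N = n⁴ m³` and `N m · 2` are polynomially bounded
  have hN : IsPolyBounded fun n => n ^ 4 * m n ^ 3 := isPolyBounded_pow_four_mul_pow_three hm
  obtain ⟨d, hd⟩ := IsPolyBounded.eventually_le_pow (isPolyBounded_pow_four_mul_pow_three_mul hm)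
  -- (1) repetitions: `N e^{-n/2} < (√2)⁻ⁿ ≤ η/4` eventually
  have h1 := eventually_mul_exp_neg_half_lt hN
  have hsqrt2 : ∀ᶠ n : ℕ in atTop, (Real.sqrt 2)⁻¹ ^ n ≤ η / 4 := by
    have hlt1 : (Real.sqrt 2)⁻¹ < 1 := by
      rw [inv_lt_one_iff₀]
      right
      rw [Real.lt_sqrt zero_le_one]
      norm_num
    have := tendsto_pow_atTop_nhds_zero_of_lt_one (inv_nonneg.2 (Real.sqrt_nonneg 2)) hlt1
    exact this.eventually (ge_mem_nhds (by positivity))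
  -- (2) test (b): `e^{-N/32} ≤ e^{-n/32} ≤ η/4` eventually
  have h2 : ∀ᶠ n : ℕ in atTop, Real.exp (-((n : ℝ) / 32)) ≤ η / 4 := by
    have ht : Tendsto (fun n : ℕ => Real.exp (-((n : ℝ) / 32))) atTop (𝓝 0) := by
      refine Real.tendsto_exp_atBot.comp ?_
      refine tendsto_neg_atTop_atBot.comp ?_
      exact Tendsto.atTop_div_const (by norm_num) tendsto_natCast_atTop_atTop
    exact ht.eventually (ge_mem_nhds (by positivity))
  -- (4) `N σ ≤ 2 N m 2⁻ⁿ ≤ 2 n^d 2⁻ⁿ ≤ η/4` eventually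
  have h4 := eventually_mul_pow_le_two_pow d (8 / η)
  -- (3) `2⁻ⁿ ≤ η/4` eventually
  have h3 : ∀ᶠ n : ℕ in atTop, (2⁻¹ : ℝ) ^ n ≤ η / 4 :=
    (tendsto_pow_atTop_nhds_zero_of_lt_one (by norm_num) (by norm_num)).eventually
      (ge_mem_nhds (by positivity))
  filter_upwards [h1, hsqrt2, h2, h3, h4, hd, eventually_ge_atTop 192] with n h1n hs2n h2n h3n h4n hdn hn192
  have hnR : (192 : ℝ) ≤ n := by exact_mod_cast hn192
  have hn0 : (0 : ℝ) < n := by linarith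
  have hm1n : (1 : ℝ) ≤ m n := by exact_mod_cast hm1 n
  have hNdef : (((n ^ 4 * m n ^ 3 : ℕ)) : ℝ) = (n : ℝ) ^ 4 * (m n : ℝ) ^ 3 := by push_cast; ring
  -- term 1
  have hT1 : ((n : ℝ) ^ 4 * (m n : ℝ) ^ 3) * Real.exp (-((n : ℝ) / 2)) ≤ η / 4 := by
    rw [← hNdef]
    exact (h1n.le).trans hs2n
  -- term 2
  have hT2 : Real.exp (-(((n : ℝ) ^ 4 * (m n : ℝ) ^ 3) * (1 / 2 - 2 * (2⁻¹ : ℝ) ^ n) ^ 2 / 2)) ≤ η / 4 := by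
    have hN0 : (0 : ℝ) ≤ (n : ℝ) ^ 4 * (m n : ℝ) ^ 3 := by positivity
    refine (exp_neg_hoeffding_le (by omega) hN0).trans (le_trans ?_ h2n)
    rw [Real.exp_le_exp, neg_le_neg_iff, div_le_div_iff_of_pos_right (by norm_num)]
    calc (n : ℝ) = (n : ℝ) ^ 1 * 1 := by ring
      _ ≤ (n : ℝ) ^ 4 * (m n : ℝ) ^ 3 := by
          gcongr
          · exact le_trans (by norm_num) hnR
          · norm_num
          · exact one_le_pow₀ hm1n
  -- term 3
  have hT3 := lemma520_main_term_le_of_repaired hn192 (hm1 n)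
  -- term 4
  have hT4 : ((n : ℝ) ^ 4 * (m n : ℝ) ^ 3) *
      ((m n : ℝ) * ((1 + (2⁻¹ : ℝ) ^ n) / (1 - (2⁻¹ : ℝ) ^ n) * (2⁻¹ : ℝ) ^ n)) ≤ η / 4 := by
    have hε : (2⁻¹ : ℝ) ^ n ≤ 1 / 4 := by
      calc (2⁻¹ : ℝ) ^ n ≤ (2⁻¹ : ℝ) ^ 2 := pow_le_pow_of_le_one (by norm_num) (by norm_num) (by omega)
        _ = 1 / 4 := by norm_num
    have hε0 : 0 < (2⁻¹ : ℝ) ^ n := by positivity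
    have hratio : (1 + (2⁻¹ : ℝ) ^ n) / (1 - (2⁻¹ : ℝ) ^ n) ≤ 2 := by
      rw [div_le_iff₀ (by linarith)]
      linarith
    have hNm : ((n : ℝ) ^ 4 * (m n : ℝ) ^ 3) * (m n : ℝ) ≤ (n : ℝ) ^ d := by
      have : ((n ^ 4 * m n ^ 3 * m n : ℕ) : ℝ) ≤ ((n ^ d : ℕ) : ℝ) := by exact_mod_cast hdn
      push_cast at this
      linarith
    have h2n : (2⁻¹ : ℝ) ^ n = 1 / 2 ^ n := by rw [inv_pow, one_div]
    have h4n' : 8 / η * (n : ℝ) ^ d ≤ 2 ^ n := h4n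
    have h2pos : (0 : ℝ) < 2 ^ n := by positivity
    calc ((n : ℝ) ^ 4 * (m n : ℝ) ^ 3) * ((m n : ℝ) * ((1 + (2⁻¹ : ℝ) ^ n) / (1 - (2⁻¹ : ℝ) ^ n) * (2⁻¹ : ℝ) ^ n))
        = (((n : ℝ) ^ 4 * (m n : ℝ) ^ 3) * (m n : ℝ)) *
            ((1 + (2⁻¹ : ℝ) ^ n) / (1 - (2⁻¹ : ℝ) ^ n)) * (2⁻¹ : ℝ) ^ n := by ring
      _ ≤ (n : ℝ) ^ d * 2 * (2⁻¹ : ℝ) ^ n := by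
          gcongr
          · exact div_nonneg (by linarith) (by linarith)
      _ ≤ η / 4 := by
          rw [h2n, mul_one_div, div_le_div_iff₀ h2pos (by norm_num)]
          have := mul_le_mul_of_nonneg_left h4n' hη.le
          have hrew : η * (8 / η * (n : ℝ) ^ d) = 8 * (n : ℝ) ^ d := by field_simp
          rw [hrew] at this
          nlinarith
  have hη4 : (2⁻¹ : ℝ) ^ n ≤ η / 4 := h3n
  linarith [hT3.trans hη4]

end MicciancioRegev2007

end Literature.Computability.Cryptography

end
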